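import Mathlib.RingTheory.Smooth.StandardSmooth
import Mathlib.RingTheory.Extension.Presentation.Submersive
import Mathlib.Algebra.MvPolynomial.PDeriv
import Mathlib.LinearAlgebra.Matrix.Block
import HarnessLib

/-!
# Standard smooth presentations through prescribed elements (Stacks 07EY = Lemma 16.3.6)

Topic: `Literature/AlgebraicGeometry/Resolution`. Groundwork for Stacks, Lemma 07F4 (and
through it for `Stacks07F5_reduceToField`, `NeronPopescuSteps.lean`). The Stacks Project,
*Smoothing Ring Maps*, Lemma 07EY (= Lemma 16.3.6):

> Let `R → A` be a standard smooth ring map. Let `E ⊂ A` be a finite subset of order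
> `|E| = n`. Then there exists a presentation `A = R[x_1, …, x_{n+m}]/(f_1, …, f_c)` with
> `c ≥ n`, with `det(∂f_j/∂x_i)_{i,j = 1, …, c}` invertible in `A`, and such that `E` is the
> set of congruence classes of `x_1, …, x_n`.
>
> *Proof.* Choose a presentation `A = R[y_1, …, y_m]/(g_1, …, g_d)` such that the image of
> `det(∂g_j/∂y_i)_{i,j = 1, …, d}` is invertible in `A`. Choose an enumeration
> `E = {a_1, …, a_n}` and choose `h_i ∈ R[y_1, …, y_m]` whose image in `A` is `a_i`. Consider
> the presentation `A = R[x_1, …, x_n, y_1, …, y_m]/(x_1 - h_1, …, x_n - h_n, g_1, …, g_d)`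
> and set `c = n + d`.

"Standard smooth" is Mathlib's `Algebra.IsStandardSmooth` (existence of a
`SubmersivePresentation`: finitely many generators and relations, an injection `map` from
relations to variables, and the Jacobian `det(∂f_j/∂x_{map(i)})` a unit). This file PROVES:

* `sub_rename_aeval_mem_span` — the substitution lemma: for `h : ι' → R[y]`, every
  `p ∈ R[y, x]` is congruent to the result of substituting `h_i` for `x_i` modulo
  `(x_i - h_i)`;
* `ker_aeval_extend` — the kernel of `R[y, x] → A`, `y ↦ v`, `x_i ↦ h_i(v)`, is
  `(x_i - h_i) + (ker(R[y] → A)) R[y, x]`;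
* `exists_submersivePresentation_extend` — 07EY at the level of Mathlib's
  `Algebra.SubmersivePresentation`: given a submersive presentation and `a : ι' → A` (`ι'`
  finite) there is a submersive presentation whose generators contain the `a_i` (as the
  variables `inr i`), with the relations `x_i - h_i` added and `map` extended by
  `inr i ↦ inr i` (the printed presentation, before renumbering);
* `exists_submersivePresentation_reindex_fin`, `exists_submersivePresentation_fin_extend` —
  **07EY as printed**: for `A` standard smooth and `a_1, …, a_n ∈ A` a submersive presentation
  with variables `Fin N`, relations `Fin c`, `n ≤ c ≤ N`, `map` the inclusion of the first `c`
  variables (so "`det(∂f_j/∂x_i)_{i,j = 1, …, c}` is invertible") and `x_i ↦ a_i` for `i ≤ n`.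

No new notions, no named facts.

## Sources

* The Stacks Project, *Smoothing Ring Maps* (Tag 07BW), Lemma 07EY (16.3.6) and its proof;
  used in the proof of Lemma 07F4. [StacksProject]
-/

noncomputable section

open MvPolynomial

namespace Literature.AlgebraicGeometry.Resolution

universe u

/-! ## Substituting polynomials for extra variables -/

section Subst

variable {R : Type u} [CommRing R] {ι ι' : Type*}

/-- **Substitution lemma.** For polynomials `h_i ∈ R[y]` (`i ∈ ι'`), every `p ∈ R[y, x]`
satisfies `p ≡ p(y, h(y)) mod (x_i - h_i : i ∈ ι')`, where `p(y, h(y)) ∈ R[y] ⊆ R[y, x]` is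
obtained by substituting `h_i` for `x_i`. [folklore] -/
theorem sub_rename_aeval_mem_span (h : ι' → MvPolynomial ι R) (p : MvPolynomial (ι ⊕ ι') R) :
    p - rename Sum.inl (aeval (Sum.elim X h) p) ∈
      Ideal.span (Set.range fun i : ι' =>
        (X (Sum.inr i) : MvPolynomial (ι ⊕ ι') R) - rename Sum.inl (h i)) := by
  induction p using MvPolynomial.induction_on with
  | C a =>
    have h0 : (C a : MvPolynomial (ι ⊕ ι') R) - rename Sum.inl (aeval (Sum.elim X h) (C a)) = 0 := by
      rw [algHom_C, algebraMap_eq, rename_C, sub_self]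
    rw [h0]
    exact Ideal.zero_mem _
  | add p q hp hq =>
    have hadd : p + q - rename Sum.inl (aeval (Sum.elim X h) (p + q)) =
        (p - rename Sum.inl (aeval (Sum.elim X h) p)) +
          (q - rename Sum.inl (aeval (Sum.elim X h) q)) := by
      rw [map_add, map_add]
      ring
    rw [hadd]
    exact Ideal.add_mem _ hp hq
  | mul_X p j hp =>
    rcases j with k | i
    · have hmul : p * X (Sum.inl k) - rename Sum.inl (aeval (Sum.elim X h) (p * X (Sum.inl k))) =
          (p - rename Sum.inl (aeval (Sum.elim X h) p)) * X (Sum.inl k) := by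
        rw [map_mul, aeval_X, Sum.elim_inl, map_mul, rename_X]
        ring
      rw [hmul]
      exact Ideal.mul_mem_right _ _ hp
    · have hmul : p * X (Sum.inr i) - rename Sum.inl (aeval (Sum.elim X h) (p * X (Sum.inr i))) =
          (p - rename Sum.inl (aeval (Sum.elim X h) p)) * X (Sum.inr i) +
            rename Sum.inl (aeval (Sum.elim X h) p) *
              (X (Sum.inr i) - rename Sum.inl (h i)) := by
        rw [map_mul, aeval_X, Sum.elim_inr, map_mul]
        ring
      rw [hmul]
      exact Ideal.add_mem _ (Ideal.mul_mem_right _ _ hp)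
        (Ideal.mul_mem_left _ _ (Ideal.subset_span ⟨i, rfl⟩))

variable {A : Type u} [CommRing A] [Algebra R A]

/-- The substitution `x_i ↦ h_i` is compatible with the evaluations `y ↦ v`, `x_i ↦ h_i(v)`.
[folklore] -/
theorem aeval_aeval_sumElim_X (v : ι → A) (h : ι' → MvPolynomial ι R) (p : MvPolynomial (ι ⊕ ι') R) :
    aeval v (aeval (Sum.elim X h) p) = aeval (Sum.elim v fun i => aeval v (h i)) p := by
  rw [← AlgHom.comp_apply]
  congr 1
  refine MvPolynomial.algHom_ext fun j => ?_
  rcases j with k | i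
  · simp
  · simp

/-- **Kernel of an extended evaluation.** For `v : ι → A` and `h : ι' → R[y]`, the kernel of
`R[y, x] → A`, `y ↦ v`, `x_i ↦ h_i(v)` is generated by the `x_i - h_i` and the kernel of
`R[y] → A`, `y ↦ v`. [folklore] -/
theorem ker_aeval_extend (v : ι → A) (h : ι' → MvPolynomial ι R) :
    RingHom.ker (aeval (Sum.elim v fun i => aeval v (h i)) : MvPolynomial (ι ⊕ ι') R →ₐ[R] A) =
      Ideal.span (Set.range fun i : ι' =>
          (X (Sum.inr i) : MvPolynomial (ι ⊕ ι') R) - rename Sum.inl (h i)) ⊔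
        (RingHom.ker (aeval v : MvPolynomial ι R →ₐ[R] A)).map
          (rename Sum.inl : MvPolynomial ι R →ₐ[R] MvPolynomial (ι ⊕ ι') R) := by
  apply le_antisymm
  · intro p hp
    rw [RingHom.mem_ker] at hp
    have hsplit : p = (p - rename Sum.inl (aeval (Sum.elim X h) p)) +
        rename Sum.inl (aeval (Sum.elim X h) p) := by ring
    rw [hsplit]
    refine Ideal.add_mem _ (Ideal.mem_sup_left (sub_rename_aeval_mem_span h p))
      (Ideal.mem_sup_right (Ideal.mem_map_of_mem _ ?_))
    rw [RingHom.mem_ker]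
    change aeval v (aeval (Sum.elim X h) p) = 0
    rw [aeval_aeval_sumElim_X, hp]
  · refine sup_le ?_ ?_
    · rw [Ideal.span_le]
      rintro _ ⟨i, rfl⟩
      rw [SetLike.mem_coe, RingHom.mem_ker, map_sub]
      change aeval _ (X (Sum.inr i)) - aeval _ (rename Sum.inl (h i)) = 0
      rw [aeval_X, Sum.elim_inr, aeval_rename, sub_eq_zero]
      rfl
    · rw [Ideal.map_le_iff_le_comap]
      intro q hq
      rw [RingHom.mem_ker] at hq
      rw [Ideal.mem_comap, RingHom.mem_ker]
      change aeval _ (rename Sum.inl q) = 0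
      rw [aeval_rename]
      exact hq

end Subst

/-! ## Stacks 07EY: extending a submersive presentation by prescribed elements -/

section Extend

variable {R A : Type u} [CommRing R] [CommRing A] [Algebra R A] {ι σ ι' : Type}

/-- **Stacks 07EY (Lemma 16.3.6), presentation form.** Given a submersive presentation
`A = R[y]/(g)` (Jacobian with respect to `map` a unit) and finitely many elements
`a : ι' → A`, the presentation `A = R[y, x]/(g, x_i - h_i)` — `h_i ∈ R[y]` lifting `a_i`, the
new variables `x_i = inr i` mapping to `a_i`, `map` extended by `inr i ↦ inr i` — is again
submersive (its Jacobian matrix is block triangular with blocks the Jacobian matrix of `(g)`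
and the identity). [cite: StacksProject, Tag 07EY] -/
theorem exists_submersivePresentation_extend [Finite σ] [Finite ι']
    (P : Algebra.SubmersivePresentation R A ι σ) (a : ι' → A) :
    ∃ Q : Algebra.SubmersivePresentation R A (ι ⊕ ι') (σ ⊕ ι'),
      (∀ k : ι, Q.val (Sum.inl k) = P.val k) ∧ (∀ i : ι', Q.val (Sum.inr i) = a i) ∧
      (∀ r : σ, Q.map (Sum.inl r) = Sum.inl (P.map r)) ∧
      (∀ i : ι', Q.map (Sum.inr i) = Sum.inr i) ∧
      (∀ r : σ, Q.relation (Sum.inl r) = rename Sum.inl (P.relation r)) ∧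
      (∀ i : ι', Q.relation (Sum.inr i) = X (Sum.inr i) - rename Sum.inl (P.σ (a i))) := by
  classical
  cases nonempty_fintype σ
  cases nonempty_fintype ι'
  -- the lifts `h_i` of `a_i`
  let h : ι' → MvPolynomial ι R := fun i => P.σ (a i)
  have hh : ∀ i, aeval P.val (h i) = a i := fun i => P.aeval_val_σ (a i)
  -- generators `y, x`
  let G : Algebra.Generators R A (ι ⊕ ι') := P.toGenerators.extend a
  have hGval : G.val = Sum.elim P.val fun i => aeval P.val (h i) := by
    funext j
    rcases j with k | i
    · rfl
    · exact (hh i).symm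
  -- relations
  let rel : σ ⊕ ι' → MvPolynomial (ι ⊕ ι') R :=
    Sum.elim (fun r => rename Sum.inl (P.relation r)) (fun i => X (Sum.inr i) - rename Sum.inl (h i))
  have hspan : Ideal.span (Set.range rel) = G.ker := by
    rw [G.ker_eq_ker_aeval_val, hGval, ker_aeval_extend, Set.Sum.elim_range, Ideal.span_union,
      sup_comm]
    congr 1
    rw [← P.ker_eq_ker_aeval_val, ← P.span_range_relation_eq_ker, Ideal.map_span, ← Set.range_comp]
    rfl
  let Q₀ : Algebra.PreSubmersivePresentation R A (ι ⊕ ι') (σ ⊕ ι') :=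
    { toGenerators := G
      relation := rel
      span_range_relation_eq_ker := hspan
      map := Sum.map P.map id
      map_inj := Sum.map_injective.mpr ⟨P.map_inj, Function.injective_id⟩ }
  -- derivatives in the new variables of polynomials in the old ones vanish
  have hvan : ∀ (i : ι') (q : MvPolynomial ι R), pderiv (Sum.inr i) (rename Sum.inl q) = 0 := by
    intro i q
    refine pderiv_eq_zero_of_notMem_vars fun hmem => ?_
    have hsub := vars_rename Sum.inl q hmem
    simp only [Finset.mem_image] at hsub
    obtain ⟨k, -, hk⟩ := hsub
    exact Sum.inl_ne_inr hk
  -- the Jacobian matrix is block triangular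
  have hJ : Q₀.jacobiMatrix = Matrix.fromBlocks
      (P.jacobiMatrix.map (rename Sum.inl))
      (Matrix.of fun (r : σ) (i : ι') => pderiv (Sum.inl (P.map r)) (rel (Sum.inr i)))
      0 1 := by
    refine Matrix.ext fun x y => ?_
    rw [Q₀.jacobiMatrix_apply]
    rcases x with r | i <;> rcases y with r' | i'
    · -- `∂g_{r'}/∂y_{map r}`
      rw [Matrix.fromBlocks_apply₁₁, Matrix.map_apply, P.jacobiMatrix_apply]
      change pderiv (Sum.inl (P.map r)) (rename Sum.inl (P.relation r')) = _
      rw [pderiv_rename Sum.inl_injective]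
    · -- `∂(x_{i'} - h_{i'})/∂y_{map r}`
      rw [Matrix.fromBlocks_apply₁₂, Matrix.of_apply]
      rfl
    · -- `∂g_{r'}/∂x_i = 0`
      rw [Matrix.fromBlocks_apply₂₁, Matrix.zero_apply]
      exact hvan i (P.relation r')
    · -- `∂(x_{i'} - h_{i'})/∂x_i = δ_{i i'}`
      rw [Matrix.fromBlocks_apply₂₂, Matrix.one_apply]
      change pderiv (Sum.inr i) (X (Sum.inr i') - rename Sum.inl (h i')) = _
      rw [map_sub, hvan i (h i'), sub_zero, pderiv_X, Pi.single_apply]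
      simp only [Sum.inr.injEq]
      split_ifs with h₁ h₂ h₂
      · rfl
      · exact absurd h₁.symm h₂
      · exact absurd h₂.symm h₁
      · rfl
  have hdet : Q₀.jacobiMatrix.det = rename Sum.inl P.jacobiMatrix.det := by
    rw [hJ, Matrix.det_fromBlocks_zero₂₁, Matrix.det_one, mul_one, AlgHom.map_det,
      AlgHom.mapMatrix_apply]
  have hunit : IsUnit Q₀.jacobian := by
    rw [Q₀.jacobian_eq_jacobiMatrix_det, hdet, Algebra.Generators.algebraMap_apply]
    change IsUnit (aeval G.val (rename Sum.inl P.jacobiMatrix.det))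
    rw [aeval_rename, hGval]
    change IsUnit (aeval (Sum.elim P.val (fun i => aeval P.val (h i)) ∘ Sum.inl) P.jacobiMatrix.det)
    rw [Sum.elim_comp_inl, ← P.algebraMap_apply, ← P.jacobian_eq_jacobiMatrix_det]
    exact P.jacobian_isUnit
  refine ⟨{ toPreSubmersivePresentation := Q₀, jacobian_isUnit := hunit }, fun k => rfl,
    fun i => rfl, fun r => rfl, fun i => rfl, fun r => rfl, fun i => rfl⟩

end Extend

/-! ## Renumbering: the prescribed elements first, `map` the initial segment -/

section Renumber

variable {R A : Type u} [CommRing R] [CommRing A] [Algebra R A]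

/-- Renumbering a submersive presentation: variables indexed by `Fin N` and relations by
`Fin c` with `map` the inclusion of the first `c` variables, and `c₁` chosen relations put
first (so that the variables `map` of these come first). [folklore] -/
theorem exists_submersivePresentation_reindex_fin {ι σ : Type} [Finite ι] [Finite σ]
    (Q : Algebra.SubmersivePresentation R A ι σ) {n : ℕ} (g : Fin n ↪ σ) :
    ∃ (N c : ℕ) (hnc : n ≤ c) (hcN : c ≤ N) (P : Algebra.SubmersivePresentation R A (Fin N) (Fin c)),
      (∀ i : Fin n, P.val (Fin.castLE (hnc.trans hcN) i) = Q.val (Q.map (g i))) ∧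
      (∀ j : Fin c, P.map j = Fin.castLE hcN j) := by
  classical
  cases nonempty_fintype ι
  cases nonempty_fintype σ
  -- order the relations: the `g i` first
  let s : Set σ := Set.range g
  let k₁ := Fintype.card (sᶜ : Set σ)
  let c := n + k₁
  let f₀ : Fin n ⊕ (sᶜ : Set σ) ≃ σ :=
    (Equiv.sumCongr (Equiv.ofInjective g g.injective) (Equiv.refl _)).trans (Equiv.Set.sumCompl s)
  let f : Fin c ≃ σ :=
    (finSumFinEquiv.symm.trans (Equiv.sumCongr (Equiv.refl (Fin n)) (Fintype.equivFin _).symm)).trans f₀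
  have hf : ∀ i : Fin n, f (Fin.castLE (Nat.le_add_right n k₁) i) = g i := by
    intro i
    have h1 : (finSumFinEquiv.symm (Fin.castLE (Nat.le_add_right n k₁) i) : Fin n ⊕ Fin k₁) =
        Sum.inl i := by
      rw [Equiv.symm_apply_eq, finSumFinEquiv_apply_left]
      rfl
    simp only [f, f₀, Equiv.trans_apply, h1, Equiv.sumCongr_apply, Sum.map_inl, Equiv.refl_apply]
    rw [Equiv.Set.sumCompl_apply_inl]
    rfl
  -- order the variables: `map (f j)` first
  let t : Set ι := Set.range (Q.map ∘ f)
  let k₂ := Fintype.card (tᶜ : Set ι)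
  let N := c + k₂
  have hinj : Function.Injective (Q.map ∘ f) := Q.map_inj.comp f.injective
  let e₀ : Fin c ⊕ (tᶜ : Set ι) ≃ ι :=
    (Equiv.sumCongr (Equiv.ofInjective _ hinj) (Equiv.refl _)).trans (Equiv.Set.sumCompl t)
  let e : Fin N ≃ ι :=
    (finSumFinEquiv.symm.trans (Equiv.sumCongr (Equiv.refl (Fin c)) (Fintype.equivFin _).symm)).trans e₀
  have he : ∀ j : Fin c, e (Fin.castLE (Nat.le_add_right c k₂) j) = Q.map (f j) := by
    intro j
    have h1 : (finSumFinEquiv.symm (Fin.castLE (Nat.le_add_right c k₂) j) : Fin c ⊕ Fin k₂) =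
        Sum.inl j := by
      rw [Equiv.symm_apply_eq, finSumFinEquiv_apply_left]
      rfl
    simp only [e, e₀, Equiv.trans_apply, h1, Equiv.sumCongr_apply, Sum.map_inl, Equiv.refl_apply]
    rw [Equiv.Set.sumCompl_apply_inl]
    rfl
  refine ⟨N, c, Nat.le_add_right n k₁, Nat.le_add_right c k₂, Q.reindex e f, fun i => ?_, fun j => ?_⟩
  · have h2 : Fin.castLE ((Nat.le_add_right n k₁).trans (Nat.le_add_right c k₂)) i =
        Fin.castLE (Nat.le_add_right c k₂) (Fin.castLE (Nat.le_add_right n k₁) i) := Fin.ext rfl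
    change Q.val (e (Fin.castLE _ i)) = _
    rw [h2, he, hf]
  · change e.symm (Q.map (f j)) = _
    rw [Equiv.symm_apply_eq, he]

/-- **Stacks 07EY (Lemma 16.3.6).** Let `A` be standard smooth over `R` and `a_1, …, a_n ∈ A`.
Then there is a presentation `A = R[x_1, …, x_N]/(f_1, …, f_c)` with `n ≤ c ≤ N`, with
`det(∂f_j/∂x_i)_{i,j = 1, …, c}` invertible in `A` (a submersive presentation whose `map` is
the inclusion of the first `c` variables), and such that `a_i` is the class of `x_i` for
`i ≤ n`. [cite: StacksProject, Tag 07EY] -/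
theorem exists_submersivePresentation_fin_extend [Algebra.IsStandardSmooth R A] {n : ℕ}
    (a : Fin n → A) :
    ∃ (N c : ℕ) (hnc : n ≤ c) (hcN : c ≤ N) (P : Algebra.SubmersivePresentation R A (Fin N) (Fin c)),
      (∀ i : Fin n, P.val (Fin.castLE (hnc.trans hcN) i) = a i) ∧
      (∀ j : Fin c, P.map j = Fin.castLE hcN j) := by
  obtain ⟨ι, σ, _, hι, ⟨P₀⟩⟩ := Algebra.IsStandardSmooth.out (R := R) (S := A)
  haveI := hι
  obtain ⟨Q, -, hval, -, hmap, -, -⟩ := exists_submersivePresentation_extend P₀ a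
  obtain ⟨N, c, hnc, hcN, P, hP, hPmap⟩ :=
    exists_submersivePresentation_reindex_fin Q ⟨Sum.inr, Sum.inr_injective⟩
  refine ⟨N, c, hnc, hcN, P, fun i => ?_, hPmap⟩
  rw [hP]
  change Q.val (Q.map (Sum.inr i)) = a i
  rw [hmap, hval]

end Renumber

end Literature.AlgebraicGeometry.Resolution

end
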